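import Summits.AnomalousDissipation.AnomalousDissipation.Theorems.KolmogorovFloor.Negative.ThreeModesBase
import Literature.Analysis.FluidPDE.NSUniqueness2DParts

/-!
# The floor at a laminar ray dressed with two waves (negative side of `KolmogorovFloor`, stmt-14030)

cdisprove seat `refuter-cdisprove-stmt-AnomalousDissipation-14030-0` (2026-08-16). The FLOOR inequality at the
three-mode state `u = Re(e_{k₀}⊗z₀) + Re(e_p⊗z_A) + Re(e_{p+q}⊗z_B)` (a resolved laminar base mode carrying two
unresolved transversal waves, the wave part of the injection signed non-negative) bounds the beat gain PLUS THE
ENERGY-CHANNEL DEFICIT of the base, `−2θ₁·Re⟪z₀, f̂(k₀)⟫`, by the injection through the multiplier at the base,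
the drift of the base mode, and `(1+2Θ)` times the viscous price of base and waves (`floor_beat_laminar`). The
enstrophy of the dressed state is split as `‖∇(u_b − (−u_w))‖² ≤ 2‖∇u_b‖² + 2‖∇u_w‖²` (`eGradNormSq_sub_le`).
Input of `Negative/WeightsVanish.lean` (every witness of the crux has weights `|θ₁| = O(ν^{1/4})`).
-/

noncomputable section

open MeasureTheory UnitAddTorus Matrix
open scoped InnerProductSpace ENNReal ComplexConjugate

namespace Summit.AnomalousDissipation.AnomalousDissipation.Theorems.KolmogorovFloor.Negative

open Literature.Analysis.FunctionSpaces Literature.Analysis.FluidPDE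
open Summit.AnomalousDissipation.AnomalousDissipation.Theorems.TaylorCertificatePair.Negative

/-- A single real mode is odd in its polarisation. -/
theorem mode_neg (k : Fin 3 → ℤ) (z : (EuclideanSpace ℂ (Fin 3))) (x : (UnitAddTorus (Fin 3))) :
    (Torus.realTrigPoly {k} (fun _ => -z)) x = -((Torus.realTrigPoly {k} (fun _ => z)) x) := by
  rw [mode_apply, mode_apply, smul_neg, map_neg]

/-- The dressed laminar state is the base minus the negated waves, pointwise. -/
theorem modes_three_split (k₀ p q : Fin 3 → ℤ) (z₀ zA zB : (EuclideanSpace ℂ (Fin 3))) :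
    ((∑ mm, Torus.realTrigPoly {![k₀, p, p + q] mm} (fun _ => ![z₀, zA, zB] mm)) : (UnitAddTorus (Fin 3)) → (EuclideanSpace ℝ (Fin 3))) = (∑ mm, Torus.realTrigPoly {![k₀] mm} (fun _ => ![z₀] mm)) - (∑ mm, Torus.realTrigPoly {![p, p + q] mm} (fun _ => ![-zA, -zB] mm)) := by
  rw [modes_eq_fun, modes_eq_fun, modes_eq_fun]
  funext x
  simp only [Pi.sub_apply, one_smul, Fin.sum_univ_three, Fin.sum_univ_two, Fin.sum_univ_one,
    Matrix.cons_val_zero, Matrix.cons_val_one, Matrix.cons_val_two, Matrix.head_cons, Matrix.tail_cons,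
    Matrix.cons_val_fin_one, mode_apply, smul_neg, map_neg]
  abel

/-- **Viscous price of the dressed laminar state**: `‖∇u‖² ≤ 2·4π²L₀²‖z₀‖² + 2·4π²L²(‖z_A‖+‖z_B‖)²` (as a real
bound on `(eGradNormSq u).toReal`). -/
theorem toReal_eGradNormSq_three_le {k₀ p q : Fin 3 → ℤ} {z₀ zA zB : (EuclideanSpace ℂ (Fin 3))} {L₀ L : ℕ}
    (hk : Torus.freqNormSq k₀ ≤ (L₀ : ℝ) ^ 2)
    (hL : ∀ m, Torus.freqNormSq ((![p, p + q] : Fin 2 → (Fin 3 → ℤ)) m) ≤ (L : ℝ) ^ 2) :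
    (Torus.eGradNormSq (∑ mm, Torus.realTrigPoly {![k₀, p, p + q] mm} (fun _ => ![z₀, zA, zB] mm))).toReal ≤
      2 * (4 * Real.pi ^ 2 * (L₀ : ℝ) ^ 2 * ‖z₀‖ ^ 2) + 2 * (4 * Real.pi ^ 2 * (L : ℝ) ^ 2 * (‖zA‖ + ‖zB‖) ^ 2) := by
  have hk1 : ∀ m, Torus.freqNormSq ((![k₀] : Fin 1 → (Fin 3 → ℤ)) m) ≤ (L₀ : ℝ) ^ 2 := by
    intro m; fin_cases m; exact hk
  have h1 := Literature.Analysis.FluidPDE.Torus.eGradNormSq_sub_le ((memLp_modes ![k₀] ![z₀]).integrable one_le_two) ((memLp_modes ![p, p + q] ![-zA, -zB]).integrable one_le_two)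
    (v := (∑ mm, Torus.realTrigPoly {![k₀] mm} (fun _ => ![z₀] mm))) (w := (∑ mm, Torus.realTrigPoly {![p, p + q] mm} (fun _ => ![-zA, -zB] mm)))
  rw [← modes_three_split] at h1
  have hfin1 : Torus.eGradNormSq (∑ mm, Torus.realTrigPoly {![k₀] mm} (fun _ => ![z₀] mm)) ≠ ⊤ := eGradNormSq_modes_ne_top
  have hfin2 : Torus.eGradNormSq (∑ mm, Torus.realTrigPoly {![p, p + q] mm} (fun _ => ![-zA, -zB] mm)) ≠ ⊤ := eGradNormSq_modes_ne_top
  have hfin : 2 * Torus.eGradNormSq (∑ mm, Torus.realTrigPoly {![k₀] mm} (fun _ => ![z₀] mm)) + 2 * Torus.eGradNormSq (∑ mm, Torus.realTrigPoly {![p, p + q] mm} (fun _ => ![-zA, -zB] mm)) ≠ ⊤ := by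
    refine ENNReal.add_ne_top.2 ⟨ENNReal.mul_ne_top (by simp) hfin1, ENNReal.mul_ne_top (by simp) hfin2⟩
  have h2 := ENNReal.toReal_mono hfin h1
  rw [ENNReal.toReal_add (ENNReal.mul_ne_top (by simp) hfin1) (ENNReal.mul_ne_top (by simp) hfin2),
    ENNReal.toReal_mul, ENNReal.toReal_mul] at h2
  simp only [ENNReal.toReal_ofNat] at h2
  have hb1 : (Torus.eGradNormSq (∑ mm, Torus.realTrigPoly {![k₀] mm} (fun _ => ![z₀] mm))).toReal ≤ 4 * Real.pi ^ 2 * (L₀ : ℝ) ^ 2 * ‖z₀‖ ^ 2 := by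
    refine (toReal_eGradNormSq_modes_le hk1).trans ?_
    refine mul_le_mul_of_nonneg_left ?_ (by positivity)
    refine integral_norm_sq_modes_le.trans ?_
    simp
  have hb2 : (Torus.eGradNormSq (∑ mm, Torus.realTrigPoly {![p, p + q] mm} (fun _ => ![-zA, -zB] mm))).toReal ≤ 4 * Real.pi ^ 2 * (L : ℝ) ^ 2 * (‖zA‖ + ‖zB‖) ^ 2 := by
    refine (toReal_eGradNormSq_modes_le hL).trans ?_
    refine mul_le_mul_of_nonneg_left ?_ (by positivity)
    refine integral_norm_sq_modes_le.trans ?_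
    simp only [Fin.sum_univ_two, Matrix.cons_val_zero, Matrix.cons_val_one, norm_neg]
    exact le_rfl
  linarith

/-- **FLOOR at the dressed laminar state.** If the three-mode state (base `k₀`, waves `p`, `p+q` outside the
ball and separated from `±k₀`, wave injection signed non-negative) satisfies the floor inequality, then
`gain + ε₀ − 2θ P₀ ≤ (f, G) + ν·lapRe + (1 + 2Θ)·ν·(2·4π²L₀²‖z₀‖² + 2·4π²L²(α+α)²)`, where `G = Φ'(u_b)` is the
multiplier at the bare laminar state, `P₀ = Re⟪z₀, f̂(k₀)⟫` the base injection, `lapRe = Re⟪z₀, −4π²|k₀|²Ĝ(k₀)⟫`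
the base drift coefficient, and `−gain` bounds the beat. -/
theorem floor_beat_laminar {f : (UnitAddTorus (Fin 3)) → (EuclideanSpace ℝ (Fin 3))} (hf : Torus.IsSmooth f) {ν : ℝ} (hν : 0 < ν)
    (Φ : Torus.CylindricalTest (Fin 3)) {N : ℕ} (hΦ : ∀ i, Torus.fourierTruncate N (Φ.g i) = Φ.g i)
    {θ Θ ε₀ : ℝ} (hθ : -Θ ≤ θ) (hθ' : θ ≤ 0)
    {k₀ p q : Fin 3 → ℤ} {z₀ zA zB : (EuclideanSpace ℂ (Fin 3))} {α : ℝ}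
    (uw ub : (Torus.energySpace (Fin 3)))
    (huw : (((uw : (Torus.energySpace (Fin 3))) : (Lp (EuclideanSpace ℝ (Fin 3)) 2 (volume : Measure (UnitAddTorus (Fin 3))))) : (UnitAddTorus (Fin 3)) → (EuclideanSpace ℝ (Fin 3))) =ᵐ[volume] (∑ mm, Torus.realTrigPoly {![k₀, p, p + q] mm} (fun _ => ![z₀, zA, zB] mm))) (hub : (((ub : (Torus.energySpace (Fin 3))) : (Lp (EuclideanSpace ℝ (Fin 3)) 2 (volume : Measure (UnitAddTorus (Fin 3))))) : (UnitAddTorus (Fin 3)) → (EuclideanSpace ℝ (Fin 3))) =ᵐ[volume] (∑ mm, Torus.realTrigPoly {![k₀] mm} (fun _ => ![z₀] mm)))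
    (hs : ((fun j => ((k₀) j : ℂ)) ⬝ᵥ (WithLp.ofLp (z₀))) = 0)
    (hA : ((fun j => ((p) j : ℂ)) ⬝ᵥ (WithLp.ofLp (zA))) = 0) (hB : ((fun j => (((p + q)) j : ℂ)) ⬝ᵥ (WithLp.ofLp (zB))) = 0)
    (hBq : ((fun j => ((q) j : ℂ)) ⬝ᵥ (WithLp.ofLp (zB))) = 0)
    (hzA : ‖zA‖ ≤ α) (hzB : ‖zB‖ ≤ α)
    (hNp : (N : ℝ) ^ 2 < Torus.freqNormSq p) (hNpq : (N : ℝ) ^ 2 < Torus.freqNormSq (p + q))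
    (hN5 : (N : ℝ) ^ 2 < Torus.freqNormSq (p + (p + q)))
    (hs1 : (N : ℝ) ^ 2 < Torus.freqNormSq (p + k₀)) (hs2 : (N : ℝ) ^ 2 < Torus.freqNormSq (p - k₀))
    (hs3 : (N : ℝ) ^ 2 < Torus.freqNormSq (p + q + k₀)) (hs4 : (N : ℝ) ^ 2 < Torus.freqNormSq (p + q - k₀))
    {L₀ L : ℕ} (hk : Torus.freqNormSq k₀ ≤ (L₀ : ℝ) ^ 2)
    (hL : ∀ m, Torus.freqNormSq ((![p, p + q] : Fin 2 → (Fin 3 → ℤ)) m) ≤ (L : ℝ) ^ 2)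
    {gain : ℝ}
    (hbeat : Real.pi * (conj (((fun j => ((q) j : ℂ)) ⬝ᵥ (WithLp.ofLp (zA)))) * ⟪(mFourierCoeff (EuclideanSpace.complexify ∘ (Φ.grad ub)) q), zB⟫_ℂ).im ≤ -gain)
    (hsign : 0 ≤ (⟪zA, (mFourierCoeff (EuclideanSpace.complexify ∘ f) p)⟫_ℂ).re + (⟪zB, (mFourierCoeff (EuclideanSpace.complexify ∘ f) (p + q))⟫_ℂ).re)
    (hfloor : ε₀ ≤ ν * (Torus.eGradNormSq (((uw : (Torus.energySpace (Fin 3))) : (Lp (EuclideanSpace ℝ (Fin 3)) 2 (volume : Measure (UnitAddTorus (Fin 3))))) : (UnitAddTorus (Fin 3)) → (EuclideanSpace ℝ (Fin 3)))).toReal + Torus.nsGeneratorPairing ν f uw (Φ.grad uw) +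
      2 * θ * (Torus.pairing ((uw : (Torus.energySpace (Fin 3))) : (Lp (EuclideanSpace ℝ (Fin 3)) 2 (volume : Measure (UnitAddTorus (Fin 3))))) f - ν * (Torus.eGradNormSq (((uw : (Torus.energySpace (Fin 3))) : (Lp (EuclideanSpace ℝ (Fin 3)) 2 (volume : Measure (UnitAddTorus (Fin 3))))) : (UnitAddTorus (Fin 3)) → (EuclideanSpace ℝ (Fin 3)))).toReal)) :
    gain + ε₀ - 2 * θ * (⟪z₀, (mFourierCoeff (EuclideanSpace.complexify ∘ f) k₀)⟫_ℂ).re ≤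
      (∫ x, ⟪f x, Φ.grad ub x⟫_ℝ) +
        ν * (⟪z₀, -(((4 * Real.pi ^ 2 * Torus.freqNormSq k₀ : ℝ) : ℂ) • (mFourierCoeff (EuclideanSpace.complexify ∘ (Φ.grad ub)) k₀))⟫_ℂ).re +
        (1 + 2 * Θ) * (ν * (2 * (4 * Real.pi ^ 2 * (L₀ : ℝ) ^ 2 * ‖z₀‖ ^ 2) + 2 * (4 * Real.pi ^ 2 * (L : ℝ) ^ 2 * (α + α) ^ 2))) := by
  set G := Φ.grad ub with hGdef
  have hG : Torus.IsSmooth G := isSmooth_grad Φ ub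
  have hband : ∀ κ, (N : ℝ) ^ 2 < Torus.freqNormSq κ →
      mFourierCoeff (EuclideanSpace.complexify ∘ G) κ = 0 := fc_grad_eq_zero Φ hΦ ub
  have hband' : ∀ κ, (N : ℝ) ^ 2 < Torus.freqNormSq κ → (mFourierCoeff (EuclideanSpace.complexify ∘ G) κ) = 0 := hband
  -- the dressed state has the differential of the bare laminar state
  have hgrad : Φ.grad uw = G := by
    rw [hGdef]
    exact grad_eq_of_coords_eq Φ (coords_three_base_eq Φ hΦ hNp hNpq huw hub)
  rw [hgrad, nsGeneratorPairing_of_ae huw, pairing_of_ae huw, eGradNormSq_congr_ae' huw] at hfloor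
  have hα : 0 ≤ α := (norm_nonneg zA).trans hzA
  -- (2) Laplacian term: only the base drifts
  have h2 : ∫ x, ⟪(∑ mm, Torus.realTrigPoly {![k₀, p, p + q] mm} (fun _ => ![z₀, zA, zB] mm)) x, Torus.laplacian G x⟫_ℝ =
      (⟪z₀, -(((4 * Real.pi ^ 2 * Torus.freqNormSq k₀ : ℝ) : ℂ) • (mFourierCoeff (EuclideanSpace.complexify ∘ G) k₀))⟫_ℂ).re :=
    laplacian_three_base hG k₀ z₀ zA zB (hband' p hNp) (hband' (p + q) hNpq)
  -- (3) the beat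
  have h3 : ∫ x, ⟪Torus.fderiv G x ((∑ mm, Torus.realTrigPoly {![k₀, p, p + q] mm} (fun _ => ![z₀, zA, zB] mm)) x), (∑ mm, Torus.realTrigPoly {![k₀, p, p + q] mm} (fun _ => ![z₀, zA, zB] mm)) x⟫_ℝ ≤ -gain := by
    rw [inertial_three_base hG k₀ p q z₀ zA zB hs hA hB hBq
      (hband' _ (by rwa [add_comm])) (hband' _ hs2) (hband' _ hs1)
      (hband' _ (by rwa [← neg_sub, Torus.freqNormSq_neg])) (hband' _ (by rwa [add_comm]))
      (hband' _ hs4) (hband' _ hs3) (hband' _ (by rwa [← neg_sub, Torus.freqNormSq_neg]))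
      (hband' _ hN5) (hband' _ (by rwa [add_comm]))]
    exact hbeat
  -- (4) the injection splits
  have h4 : ∫ x, ⟪(∑ mm, Torus.realTrigPoly {![k₀, p, p + q] mm} (fun _ => ![z₀, zA, zB] mm)) x, f x⟫_ℝ =
      (⟪z₀, (mFourierCoeff (EuclideanSpace.complexify ∘ f) k₀)⟫_ℂ).re +
        ((⟪zA, (mFourierCoeff (EuclideanSpace.complexify ∘ f) p)⟫_ℂ).re + (⟪zB, (mFourierCoeff (EuclideanSpace.complexify ∘ f) (p + q))⟫_ℂ).re) :=
    pairing_three_base hf.integrable k₀ z₀ zA zB p q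
  -- (5) the viscous price
  have h5 : 0 ≤ ν * (Torus.eGradNormSq (∑ mm, Torus.realTrigPoly {![k₀, p, p + q] mm} (fun _ => ![z₀, zA, zB] mm))).toReal := by positivity
  have h6 : ν * (Torus.eGradNormSq (∑ mm, Torus.realTrigPoly {![k₀, p, p + q] mm} (fun _ => ![z₀, zA, zB] mm))).toReal ≤
      ν * (2 * (4 * Real.pi ^ 2 * (L₀ : ℝ) ^ 2 * ‖z₀‖ ^ 2) + 2 * (4 * Real.pi ^ 2 * (L : ℝ) ^ 2 * (α + α) ^ 2)) := by
    refine mul_le_mul_of_nonneg_left ?_ hν.le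
    refine (toReal_eGradNormSq_three_le hk hL).trans ?_
    have : (‖zA‖ + ‖zB‖) ^ 2 ≤ (α + α) ^ 2 :=
      pow_le_pow_left₀ (by positivity) (add_le_add hzA hzB) 2
    have hw : 2 * (4 * Real.pi ^ 2 * (L : ℝ) ^ 2 * (‖zA‖ + ‖zB‖) ^ 2) ≤ 2 * (4 * Real.pi ^ 2 * (L : ℝ) ^ 2 * (α + α) ^ 2) := by
      gcongr
    linarith
  -- (6) the energy channel: wave injection signed away, base injection kept, dissipation priced by `2Θ`
  have hΘ : 0 ≤ Θ := by linarith
  rw [h2, h4] at hfloor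
  have h7 : 2 * θ * ((⟪zA, (mFourierCoeff (EuclideanSpace.complexify ∘ f) p)⟫_ℂ).re + (⟪zB, (mFourierCoeff (EuclideanSpace.complexify ∘ f) (p + q))⟫_ℂ).re) ≤ 0 := by
    nlinarith
  have h8 : -(2 * θ) * (ν * (Torus.eGradNormSq (∑ mm, Torus.realTrigPoly {![k₀, p, p + q] mm} (fun _ => ![z₀, zA, zB] mm))).toReal) ≤
      2 * Θ * (ν * (2 * (4 * Real.pi ^ 2 * (L₀ : ℝ) ^ 2 * ‖z₀‖ ^ 2) + 2 * (4 * Real.pi ^ 2 * (L : ℝ) ^ 2 * (α + α) ^ 2))) := by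
    calc -(2 * θ) * (ν * (Torus.eGradNormSq (∑ mm, Torus.realTrigPoly {![k₀, p, p + q] mm} (fun _ => ![z₀, zA, zB] mm))).toReal)
        ≤ (2 * Θ) * (ν * (Torus.eGradNormSq (∑ mm, Torus.realTrigPoly {![k₀, p, p + q] mm} (fun _ => ![z₀, zA, zB] mm))).toReal) := mul_le_mul_of_nonneg_right (by linarith) h5
      _ ≤ 2 * Θ * (ν * (2 * (4 * Real.pi ^ 2 * (L₀ : ℝ) ^ 2 * ‖z₀‖ ^ 2) + 2 * (4 * Real.pi ^ 2 * (L : ℝ) ^ 2 * (α + α) ^ 2))) :=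
          mul_le_mul_of_nonneg_left h6 (by positivity)
  nlinarith [hfloor, h3, h6, h7, h8]


/-! ### The bare laminar state -/

/-- Inertial term of a single transversal mode against any smooth field: zero (a single Fourier mode of a
divergence-free field is a steady Euler flow). -/
theorem inertial_one {G : (UnitAddTorus (Fin 3)) → (EuclideanSpace ℝ (Fin 3))} (hG : Torus.IsSmooth G) (k₀ : Fin 3 → ℤ) (z₀ : (EuclideanSpace ℂ (Fin 3)))
    (hs : ((fun j => ((k₀) j : ℂ)) ⬝ᵥ (WithLp.ofLp (z₀))) = 0) :
    ∫ x, ⟪Torus.fderiv G x ((∑ mm, Torus.realTrigPoly {![k₀] mm} (fun _ => ![z₀] mm)) x), (∑ mm, Torus.realTrigPoly {![k₀] mm} (fun _ => ![z₀] mm)) x⟫_ℝ = 0 := by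
  rw [inertial_modes hG]
  have d00 : ((fun j => (((k₀ + k₀)) j : ℂ)) ⬝ᵥ (WithLp.ofLp (z₀))) = 0 := by rw [dotc_add_left, hs, add_zero]
  simp only [Fin.sum_univ_one, Matrix.cons_val_fin_one, sub_self, dotc_zero_left,
    d00, zero_mul, mul_zero, map_zero, Complex.zero_im, add_zero]

/-- **FLOOR at the bare laminar state**: `ε₀ − 2θ P₀ ≤ (f,G) + ν·lapRe + (1+2Θ)·ν·4π²L₀²‖z₀‖²`. -/
theorem floor_laminar_bare {f : (UnitAddTorus (Fin 3)) → (EuclideanSpace ℝ (Fin 3))} (hf : Torus.IsSmooth f) {ν : ℝ} (hν : 0 < ν)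
    (Φ : Torus.CylindricalTest (Fin 3)) {θ Θ ε₀ : ℝ} (hθ : -Θ ≤ θ) (hθ' : θ ≤ 0)
    {k₀ : Fin 3 → ℤ} {z₀ : (EuclideanSpace ℂ (Fin 3))}
    (ub : (Torus.energySpace (Fin 3))) (hub : (((ub : (Torus.energySpace (Fin 3))) : (Lp (EuclideanSpace ℝ (Fin 3)) 2 (volume : Measure (UnitAddTorus (Fin 3))))) : (UnitAddTorus (Fin 3)) → (EuclideanSpace ℝ (Fin 3))) =ᵐ[volume] (∑ mm, Torus.realTrigPoly {![k₀] mm} (fun _ => ![z₀] mm)))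
    (hs : ((fun j => ((k₀) j : ℂ)) ⬝ᵥ (WithLp.ofLp (z₀))) = 0)
    {L₀ : ℕ} (hk : Torus.freqNormSq k₀ ≤ (L₀ : ℝ) ^ 2)
    (hfloor : ε₀ ≤ ν * (Torus.eGradNormSq (((ub : (Torus.energySpace (Fin 3))) : (Lp (EuclideanSpace ℝ (Fin 3)) 2 (volume : Measure (UnitAddTorus (Fin 3))))) : (UnitAddTorus (Fin 3)) → (EuclideanSpace ℝ (Fin 3)))).toReal + Torus.nsGeneratorPairing ν f ub (Φ.grad ub) +
      2 * θ * (Torus.pairing ((ub : (Torus.energySpace (Fin 3))) : (Lp (EuclideanSpace ℝ (Fin 3)) 2 (volume : Measure (UnitAddTorus (Fin 3))))) f - ν * (Torus.eGradNormSq (((ub : (Torus.energySpace (Fin 3))) : (Lp (EuclideanSpace ℝ (Fin 3)) 2 (volume : Measure (UnitAddTorus (Fin 3))))) : (UnitAddTorus (Fin 3)) → (EuclideanSpace ℝ (Fin 3)))).toReal)) :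
    ε₀ - 2 * θ * (⟪z₀, (mFourierCoeff (EuclideanSpace.complexify ∘ f) k₀)⟫_ℂ).re ≤
      (∫ x, ⟪f x, Φ.grad ub x⟫_ℝ) +
        ν * (⟪z₀, -(((4 * Real.pi ^ 2 * Torus.freqNormSq k₀ : ℝ) : ℂ) • (mFourierCoeff (EuclideanSpace.complexify ∘ (Φ.grad ub)) k₀))⟫_ℂ).re +
        (1 + 2 * Θ) * (ν * (4 * Real.pi ^ 2 * (L₀ : ℝ) ^ 2 * ‖z₀‖ ^ 2)) := by
  set G := Φ.grad ub with hGdef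
  have hG : Torus.IsSmooth G := isSmooth_grad Φ ub
  rw [nsGeneratorPairing_of_ae hub, pairing_of_ae hub, eGradNormSq_congr_ae' hub] at hfloor
  have hk1 : ∀ m, Torus.freqNormSq ((![k₀] : Fin 1 → (Fin 3 → ℤ)) m) ≤ (L₀ : ℝ) ^ 2 := by
    intro m; fin_cases m; exact hk
  have h2 : ∫ x, ⟪(∑ mm, Torus.realTrigPoly {![k₀] mm} (fun _ => ![z₀] mm)) x, Torus.laplacian G x⟫_ℝ =
      (⟪z₀, -(((4 * Real.pi ^ 2 * Torus.freqNormSq k₀ : ℝ) : ℂ) • (mFourierCoeff (EuclideanSpace.complexify ∘ G) k₀))⟫_ℂ).re := by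
    rw [integral_inner_modes_laplacian hG]
    simp only [Fin.sum_univ_one, Matrix.cons_val_fin_one]
  have h3 : ∫ x, ⟪Torus.fderiv G x ((∑ mm, Torus.realTrigPoly {![k₀] mm} (fun _ => ![z₀] mm)) x), (∑ mm, Torus.realTrigPoly {![k₀] mm} (fun _ => ![z₀] mm)) x⟫_ℝ = 0 := inertial_one hG k₀ z₀ hs
  have h4 : ∫ x, ⟪(∑ mm, Torus.realTrigPoly {![k₀] mm} (fun _ => ![z₀] mm)) x, f x⟫_ℝ = (⟪z₀, (mFourierCoeff (EuclideanSpace.complexify ∘ f) k₀)⟫_ℂ).re := by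
    rw [integral_inner_modes_left hf.integrable]
    simp only [Fin.sum_univ_one, Matrix.cons_val_fin_one]
  have h5 : 0 ≤ ν * (Torus.eGradNormSq (∑ mm, Torus.realTrigPoly {![k₀] mm} (fun _ => ![z₀] mm))).toReal := by positivity
  have h6 : ν * (Torus.eGradNormSq (∑ mm, Torus.realTrigPoly {![k₀] mm} (fun _ => ![z₀] mm))).toReal ≤ ν * (4 * Real.pi ^ 2 * (L₀ : ℝ) ^ 2 * ‖z₀‖ ^ 2) := by
    refine mul_le_mul_of_nonneg_left ?_ hν.le
    refine (toReal_eGradNormSq_modes_le hk1).trans ?_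
    refine mul_le_mul_of_nonneg_left ?_ (by positivity)
    refine integral_norm_sq_modes_le.trans ?_
    simp
  have hΘ : 0 ≤ Θ := by linarith
  rw [h2, h3, h4] at hfloor
  have h8 : -(2 * θ) * (ν * (Torus.eGradNormSq (∑ mm, Torus.realTrigPoly {![k₀] mm} (fun _ => ![z₀] mm))).toReal) ≤ 2 * Θ * (ν * (4 * Real.pi ^ 2 * (L₀ : ℝ) ^ 2 * ‖z₀‖ ^ 2)) := by
    calc -(2 * θ) * (ν * (Torus.eGradNormSq (∑ mm, Torus.realTrigPoly {![k₀] mm} (fun _ => ![z₀] mm))).toReal)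
        ≤ (2 * Θ) * (ν * (Torus.eGradNormSq (∑ mm, Torus.realTrigPoly {![k₀] mm} (fun _ => ![z₀] mm))).toReal) := mul_le_mul_of_nonneg_right (by linarith) h5
      _ ≤ 2 * Θ * (ν * (4 * Real.pi ^ 2 * (L₀ : ℝ) ^ 2 * ‖z₀‖ ^ 2)) := mul_le_mul_of_nonneg_left h6 (by positivity)
  nlinarith [hfloor, h6, h8]

/-! ### Real endgame of the energy-channel analysis -/

/-- **Endgame for the weights.** The consequence of the floor at the dressed laminar ray,
`gain + ε₀ + deficit ≤ inj + lap + waves`, with `gain ≥ (9/10)α²gₙ ≥ inj + lap + gₙ`,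
`deficit = θσφ²/((1+2Θ)8π²L₀²ν)` and `waves ≤ 32π²(1+2Θ)·(c²Y)·α²` (`νL² ≤ c²Y`, `Y = C'²ν^{-1/2}`), gives
`θσφ² ≤ (1+2Θ)²256π⁴L₀²c²α²·(νY)`. -/
theorem endgame_weights {θ σ φ Θ L₀ ν gain ε₀ inj lap waves gn A α c Y : ℝ}
    (hν : 0 < ν) (hΘ : 0 ≤ Θ) (hL₀ : 1 ≤ L₀) (hgn : 0 ≤ gn) (hε₀ : 0 < ε₀)
    (hmain : gain + ε₀ + θ * σ * φ ^ 2 / ((1 + 2 * Θ) * (8 * Real.pi ^ 2) * L₀ ^ 2 * ν) ≤ inj + lap + waves)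
    (hgain : 9 / 10 * α ^ 2 * gn ≤ gain) (hα2 : α ^ 2 = 10 / 9 * (A + φ + 1))
    (hinj : inj ≤ A * gn) (hlap : lap ≤ φ * gn)
    (hwaves : waves ≤ 32 * Real.pi ^ 2 * (1 + 2 * Θ) * (c ^ 2 * Y) * α ^ 2) :
    θ * σ * φ ^ 2 ≤ (1 + 2 * Θ) ^ 2 * (256 * Real.pi ^ 4) * L₀ ^ 2 * c ^ 2 * α ^ 2 * (ν * Y) := by
  have hgi : inj + lap + gn ≤ gain := by
    have e : 9 / 10 * α ^ 2 * gn = A * gn + φ * gn + gn := by rw [hα2]; ring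
    nlinarith
  have hden : 0 < (1 + 2 * Θ) * (8 * Real.pi ^ 2) * L₀ ^ 2 * ν := by
    have := Real.pi_pos; positivity
  have h1 : θ * σ * φ ^ 2 / ((1 + 2 * Θ) * (8 * Real.pi ^ 2) * L₀ ^ 2 * ν) ≤ waves := by linarith
  rw [div_le_iff₀ hden] at h1
  calc θ * σ * φ ^ 2 ≤ waves * ((1 + 2 * Θ) * (8 * Real.pi ^ 2) * L₀ ^ 2 * ν) := h1
    _ ≤ (32 * Real.pi ^ 2 * (1 + 2 * Θ) * (c ^ 2 * Y) * α ^ 2) * ((1 + 2 * Θ) * (8 * Real.pi ^ 2) * L₀ ^ 2 * ν) :=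
        mul_le_mul_of_nonneg_right hwaves hden.le
    _ = (1 + 2 * Θ) ^ 2 * (256 * Real.pi ^ 4) * L₀ ^ 2 * c ^ 2 * α ^ 2 * (ν * Y) := by ring

/-- A non-zero smooth field has a non-zero Fourier coefficient. -/
theorem exists_mFourierCoeff_ne_zero {f : (UnitAddTorus (Fin 3)) → (EuclideanSpace ℝ (Fin 3))} (hf : Torus.IsSmooth f)
    (hF : 0 < ∫ x, ‖f x‖ ^ 2) : ∃ k₀ : Fin 3 → ℤ, mFourierCoeff (EuclideanSpace.complexify ∘ f) k₀ ≠ 0 := by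
  by_contra h
  push Not at h
  have hs := Torus.hasSum_sq_norm_mFourierCoeff_complexify (hf.memLp 2)
  have h0 : (fun k : Fin 3 → ℤ => ‖mFourierCoeff (EuclideanSpace.complexify ∘ f) k‖ ^ 2) = fun _ => 0 := by
    funext k; rw [h k, norm_zero]; norm_num
  rw [h0] at hs
  have := hs.unique hasSum_zero
  linarith

/-- `ν·ν^{-1/2} = ν^{1/2}` and `√(ν^{1/2}) = ν^{1/4}`. -/
theorem rpow_half_facts {ν : ℝ} (hν : 0 < ν) :
    ν * ν ^ (-(1 / 2 : ℝ)) = ν ^ (1 / 2 : ℝ) ∧ Real.sqrt (ν ^ (1 / 2 : ℝ)) = ν ^ (1 / 4 : ℝ) := by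
  constructor
  · rw [show (1 / 2 : ℝ) = 1 + (-(1 / 2 : ℝ)) by norm_num]
    rw [Real.rpow_add hν, Real.rpow_one]
    norm_num
  · rw [Real.sqrt_eq_rpow, ← Real.rpow_mul hν.le]
    norm_num

end Summit.AnomalousDissipation.AnomalousDissipation.Theorems.KolmogorovFloor.Negative
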